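import Summits.ValiantsHypothesis.ValiantsHypothesis.Theorems.LacunarySymmetroidMatrixDescartesMomentLaw
import Summits.ValiantsHypothesis.ValiantsHypothesis.Theorems.LacunarySymmetroidMatrixDescartesCensusPivotDefs

/-!
# `MatrixDescartes` (stmt-ValiantsHypothesis-18050) — the negative-moment law: PosDef form, pivot currency, SHARPNESS

HONEST FRAMING.  Cell `pub-symmetroid`, seat `val-sym-mdr-p2` (gen 10); helper `--supports` the crux, NO closure claim.
Companion of `…MomentLaw.lean` (`negMoment_posRoots_le`: a negative-definite moment `F(x₀) ≺ 0` caps the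
distinct positive zeros of `det (X^e J + ∑ X^{d k} P k)`, `J` symmetric, `P k ⪰ 0`, at `2 · card ι`).  Here:
(i) the same law with the hypothesis as Mathlib's `Matrix.PosDef` of `−F(x₀)` (`negMoment_posRoots_le_of_posDef`);
(ii) the row in the census's PIVOT currency (`…CensusPivotDefs`): `Pivot.pivotPosRoots e d J P ≤ 2m` for every format
`(m, K)` and all exponents (`pivotPosRoots_le_two_mul_of_negMoment`); (iii) SHARPNESS already at `card ι = 1`: the
scalar pencil `−X + 1/4 + X²/4` is negative at `x₀ = 1` and has the two positive zeros `2 ± √3`, one on each side of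
`x₀` (`negMoment_sharp_one`; block-diagonal copies give `2n` at every size).  Nothing here bears on the crux in its
window, on `DoorA26`/`DoorA34`, or on `VP ≠ VNP`.  [folklore] bookkeeping + intermediate value theorem.
-/

-- layout Summits/ValiantsHypothesis/ValiantsHypothesis forces the duplicated namespace component
set_option linter.dupNamespace false

namespace Summit.ValiantsHypothesis.ValiantsHypothesis.Theorems.LacunarySymmetroidMatrixDescartes

open Polynomial Matrix Finset
open scoped BigOperators

section Law

variable (ι κ : Type) [Fintype ι] [DecidableEq ι] [Fintype κ]

/-- The same law with the hypothesis stated through Mathlib's `Matrix.PosDef` (`−F(x₀)` positive definite).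
[folklore] -/
theorem negMoment_posRoots_le_of_posDef (e : ℕ) (d : κ → ℕ) (J : Matrix ι ι ℝ) (P : κ → Matrix ι ι ℝ)
    (hJ : J.IsSymm) (hP : ∀ k, (P k).PosSemidef) (x₀ : ℝ) (hx₀ : 0 < x₀)
    (hneg : (-(x₀ ^ e • J + ∑ k, x₀ ^ d k • P k)).PosDef) :
    ((Matrix.det (((Polynomial.X : Polynomial ℝ) ^ e) • J.map Polynomial.C
        + ∑ k, ((Polynomial.X : Polynomial ℝ) ^ d k) • (P k).map Polynomial.C)).roots.toFinset.filter
          (fun t => 0 < t)).card ≤ 2 * Fintype.card ι := by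
  refine negMoment_posRoots_le ι κ e d J P hJ hP x₀ hx₀ fun v hv => ?_
  have h := hneg.dotProduct_mulVec_pos hv
  rw [star_trivial, Matrix.neg_mulVec, dotProduct_neg] at h
  exact neg_pos.1 h

end Law

/-- **Pivot-currency corollary** (`…CensusPivotDefs`): a pivot pencil of format `(m, K)` with a negative-definite
moment has `Z₊ ≤ 2m`, whatever `K` and the exponents. [folklore] -/
theorem pivotPosRoots_le_two_mul_of_negMoment (m K e : ℕ) (d : Fin K → ℕ) (J : Matrix (Fin m) (Fin m) ℝ)
    (P : Fin K → Matrix (Fin m) (Fin m) ℝ) (hJ : J.IsSymm) (hP : ∀ k, (P k).PosSemidef) (x₀ : ℝ)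
    (hx₀ : 0 < x₀) (hneg : ∀ v : Fin m → ℝ, v ≠ 0 → v ⬝ᵥ ((x₀ ^ e • J + ∑ k, x₀ ^ d k • P k) *ᵥ v) < 0) :
    Pivot.pivotPosRoots e d J P ≤ 2 * m := by
  unfold Pivot.pivotPosRoots
  simpa using negMoment_posRoots_le (Fin m) (Fin K) e d J P hJ hP x₀ hx₀ hneg

/-- **Sharpness at `n = 1`**: `F(X) = −X + a + bX²` (`J = −1` at `e = 1`, letters `a` at `0`, `b` at `2`) with
`a = b = 1/4` has `F(1) = −1/2 < 0` and exactly the two positive zeros `2 ± √3`; so the constant `2·card ι` of the law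
is attained (block-diagonal copies give `2n` for every `n`).  We certify `2 ≤ Z₊` by a sign change on each side
of `x₀ = 1`. [folklore] -/
theorem negMoment_sharp_one :
    2 ≤ ((Matrix.det (((Polynomial.X : Polynomial ℝ) ^ 1) • (!![(-1 : ℝ)] : Matrix (Fin 1) (Fin 1) ℝ).map Polynomial.C
        + ∑ k, ((Polynomial.X : Polynomial ℝ) ^ (![0, 2] : Fin 2 → ℕ) k)
          • ((![!![(1/4 : ℝ)], !![(1/4 : ℝ)]] : Fin 2 → Matrix (Fin 1) (Fin 1) ℝ) k).map Polynomial.C)).roots.toFinset.filter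
          (fun t => 0 < t)).card := by
  set p := Matrix.det (((Polynomial.X : Polynomial ℝ) ^ 1) • (!![(-1 : ℝ)] : Matrix (Fin 1) (Fin 1) ℝ).map Polynomial.C
        + ∑ k, ((Polynomial.X : Polynomial ℝ) ^ (![0, 2] : Fin 2 → ℕ) k)
          • ((![!![(1/4 : ℝ)], !![(1/4 : ℝ)]] : Fin 2 → Matrix (Fin 1) (Fin 1) ℝ) k).map Polynomial.C) with hp
  have hev : ∀ t : ℝ, p.eval t = -t + 1/4 + t ^ 2 / 4 := by
    intro t
    rw [hp, StubReverse.eval_det_pencil, Matrix.det_fin_one]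
    simp [Matrix.add_apply, Fin.sum_univ_two]
    ring
  have hp0 : p ≠ 0 := fun h => by
    have := hev 0
    rw [h, Polynomial.eval_zero] at this
    norm_num at this
  -- sign changes on (1/4, 1) and (1, 4)
  have hroot : ∀ a b : ℝ, 0 < a → a < b → p.eval a * p.eval b < 0 →
      ∃ r, a < r ∧ r < b ∧ p.IsRoot r := by
    intro a b ha hab hs
    have hcont : ContinuousOn (fun x => p.eval x) (Set.Icc a b) := p.continuous.continuousOn
    rcases mul_neg_iff.1 hs with ⟨h1, h2⟩ | ⟨h1, h2⟩
    · obtain ⟨r, ⟨hr1, hr2⟩, hr⟩ := intermediate_value_Ioo' hab.le hcont ⟨h2, h1⟩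
      exact ⟨r, hr1, hr2, hr⟩
    · obtain ⟨r, ⟨hr1, hr2⟩, hr⟩ := intermediate_value_Ioo hab.le hcont ⟨h1, h2⟩
      exact ⟨r, hr1, hr2, hr⟩
  obtain ⟨r₁, hr₁a, hr₁b, hr₁⟩ := hroot (1/4) 1 (by norm_num) (by norm_num) (by rw [hev, hev]; norm_num)
  obtain ⟨r₂, hr₂a, hr₂b, hr₂⟩ := hroot 1 4 (by norm_num) (by norm_num) (by rw [hev, hev]; norm_num)
  have hne : r₁ ≠ r₂ := fun h => by rw [h] at hr₁b; exact lt_irrefl _ (hr₁b.trans hr₂a)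
  have hmem : ∀ r, 0 < r → p.IsRoot r → r ∈ p.roots.toFinset.filter (fun t => 0 < t) := fun r hr h => by
    simp only [Finset.mem_filter, Multiset.mem_toFinset, Polynomial.mem_roots hp0]
    exact ⟨h, hr⟩
  calc 2 = ({r₁, r₂} : Finset ℝ).card := by rw [Finset.card_pair hne]
    _ ≤ _ := Finset.card_le_card (by
        intro r hr
        simp only [Finset.mem_insert, Finset.mem_singleton] at hr
        rcases hr with rfl | rfl
        · exact hmem _ (by linarith) hr₁
        · exact hmem _ (by linarith) hr₂)

end Summit.ValiantsHypothesis.ValiantsHypothesis.Theorems.LacunarySymmetroidMatrixDescartes
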